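import Mathlib
import HarnessLib
import Literature.MathematicalPhysics.QuantumLattice.ChernoffProductFormula
import Literature.MathematicalPhysics.QuantumLattice.FinDimSpectrum

/-!
# BalabanIR reduction `BirGappedPhaseReductionR` (stmt-14846): slaved pair-field representation — the per-slice estimate

Support file (`--supports stmt-HubbardSuperconductivity-14846`; prover seat 2, session 11), core half
of the proof of the first lemma `SlavedPairFieldTrotter` of the crux card
`slaved-pair-field-os-dictionary` (`Cruxes/BirGappedPhaseReductionR/SketchIdeator1.lean`; passed by
both triagers, `TRIAGE-r1-{1,2}.md`).  The Trotter limit itself and the card's second lemma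
`SlavedWeightTimeReflection` are in `Theorems/BalabanIRBirGappedPhaseReductionRSlavedTrotter.lean`.

Content.  Add the pair penalty `(κ/2){B, Bᴴ}` to `H` (`H' = H + (κ/2)(BBᴴ + BᴴB)`) and subtract it
by averaging the HERMITIAN source slice `exp(aκ(φ̄ B + φ Bᴴ))` over the U(1)-symmetric four-point
surrogate `ν₄ = {φ_k = r iᵏ}_{k<4}` of the complex Gaussian with `r² = 1/(κa)`:

* moments of `ν₄` (`sum_nu4`, `sum_conj_nu4`, `sum_nu4_sq`, `sum_conj_nu4_sq`, `conj_nu4_mul_nu4`):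
  `E φ = E φ̄ = E φ² = E φ̄² = 0`, `|φ_k|² = r²`; hence the source exponents
  `W_k = conj φ_k • B + φ_k • Bᴴ` have `Σ_k W_k = 0` and `Σ_k W_k² = 4r²(BBᴴ + BᴴB)`
  (`sum_sourceExponent`, `sum_sourceExponent_sq`);
* `norm_addSubtract_step_le`, `norm_exp_mul_avg_exp_sub_exp_le`: the abstract add-and-subtract
  estimate in a complete normed `ℂ`-algebra — if `q + x = y`, `Σ Z_k = 0`, `Σ Z_k²/2 = 4q` and
  `‖Z_k‖ ≤ z` then `‖exp x · ¼Σ_k exp Z_k - exp y‖ ≤ z³eᶻ(1+‖x‖) + ‖x‖‖q‖ + ‖x‖²e^{‖x‖}(1+‖q‖+z³eᶻ)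
  + ‖y‖²e^{‖y‖}` (Taylor remainders of orders 2, 2, 3 from the tree's `LieTrotter` /
  `ChernoffProductFormula`);
* `exists_norm_slavedSlice_sub_gibbsWeight_le`: **the per-slice estimate** — for `0 ≤ a ≤ 1`,
  `aκr² = 1`, `‖e^{-aH'} · ¼Σ_{k<4} e^{aκ W_k} - e^{-aH}‖ ≤ C(H, B, κ) · a (aκr + a)`, i.e. `O(a^{3/2})`
  since `aκr = (aκ)^{1/2}`: the penalty cancels the second moment of the source slice exactly, and
  only third-order remainders `O((aκ)^{3/2} r³) = O(a^{3/2})` survive.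

Matrices carry the `L²` operator norm (`open scoped Matrix.Norms.L2Operator`, a C⋆-norm, `‖1‖ = 1`).
This is the finite-dimensional mechanism of every auxiliary-field / Hubbard–Stratonovich Trotter
decomposition (Blankenbecler–Scalapino–Sugar 1981, Hirsch 1983), here with an exact four-point
quadrature; no Hermiticity of `H` and no hypothesis on `B` is needed.
-/

noncomputable section

namespace Summit.HubbardSuperconductivity.HubbardSuperconductivity.Theorems

open scoped Matrix.Norms.L2Operator ComplexConjugate
open Matrix Filter Topology NormedSpace
open Literature.MathematicalPhysics.QuantumLattice

variable {n : Type*} [Fintype n] [DecidableEq n]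

/-! ### Moments of the four-point surrogate `ν₄ = {r iᵏ}` of the complex Gaussian -/

/-- First moment of `ν₄`: `Σ_k r iᵏ = r(1 + i - 1 - i) = 0`. [folklore] -/
theorem sum_nu4 (r : ℝ) : ∑ k : Fin 4, (r : ℂ) * Complex.I ^ (k : ℕ) = 0 := by
  rw [← Finset.mul_sum]
  simp [Fin.sum_univ_four, pow_succ]

/-- First moment of the conjugates: `Σ_k conj (r iᵏ) = r Σ_k (-i)ᵏ = 0`. [folklore] -/
theorem sum_conj_nu4 (r : ℝ) : ∑ k : Fin 4, conj ((r : ℂ) * Complex.I ^ (k : ℕ)) = 0 := by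
  simp only [map_mul, Complex.conj_ofReal, map_pow, Complex.conj_I]
  rw [← Finset.mul_sum]
  simp [Fin.sum_univ_four, pow_succ]

/-- Second moment: `Σ_k (r iᵏ)² = r² Σ_k (-1)ᵏ = 0`. [folklore] -/
theorem sum_nu4_sq (r : ℝ) : ∑ k : Fin 4, ((r : ℂ) * Complex.I ^ (k : ℕ)) ^ 2 = 0 := by
  have h : ∀ k : ℕ, ((r : ℂ) * Complex.I ^ k) ^ 2 = (r : ℂ) ^ 2 * (-1) ^ k := fun k => by
    rw [mul_pow, ← pow_mul, mul_comm k 2, pow_mul, Complex.I_sq]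
  simp only [h, ← Finset.mul_sum]
  simp [Fin.sum_univ_four, pow_succ]

/-- Second moment of the conjugates: `Σ_k conj(r iᵏ)² = 0`. [folklore] -/
theorem sum_conj_nu4_sq (r : ℝ) :
    ∑ k : Fin 4, (conj ((r : ℂ) * Complex.I ^ (k : ℕ))) ^ 2 = 0 := by
  have h : ∀ k : ℕ, (conj ((r : ℂ) * Complex.I ^ k)) ^ 2 = (r : ℂ) ^ 2 * (-1) ^ k := fun k => by
    simp only [map_mul, Complex.conj_ofReal, map_pow, Complex.conj_I]
    rw [mul_pow, ← pow_mul, mul_comm k 2, pow_mul, neg_pow_two, Complex.I_sq]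
  simp only [h, ← Finset.mul_sum]
  simp [Fin.sum_univ_four, pow_succ]

/-- `|φ_k|² = r²` pointwise: `conj(r iᵏ) · (r iᵏ) = r²`. [folklore] -/
theorem conj_nu4_mul_nu4 (r : ℝ) (k : ℕ) :
    conj ((r : ℂ) * Complex.I ^ k) * ((r : ℂ) * Complex.I ^ k) = (r : ℂ) ^ 2 := by
  simp only [map_mul, Complex.conj_ofReal, map_pow, Complex.conj_I]
  have h : (-Complex.I) ^ k * Complex.I ^ k = 1 := by
    rw [← mul_pow, neg_mul, Complex.I_mul_I, neg_neg, one_pow]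
  calc (r : ℂ) * (-Complex.I) ^ k * ((r : ℂ) * Complex.I ^ k)
      = (r : ℂ) ^ 2 * ((-Complex.I) ^ k * Complex.I ^ k) := by ring
    _ = (r : ℂ) ^ 2 := by rw [h, mul_one]

/-- `‖r iᵏ‖ = |r|`. [folklore] -/
theorem norm_nu4 (r : ℝ) (k : ℕ) : ‖(r : ℂ) * Complex.I ^ k‖ = |r| := by
  rw [norm_mul, norm_pow, Complex.norm_I, one_pow, mul_one, Complex.norm_real, Real.norm_eq_abs]

/-! ### The averaged source slice: first and second operator moments -/

omit [Fintype n] [DecidableEq n] in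
/-- The source exponents average to zero: `Σ_k (conj φ_k • B + φ_k • Bᴴ) = 0`. [folklore] -/
theorem sum_sourceExponent (r : ℝ) (B : Matrix n n ℂ) :
    ∑ k : Fin 4, (conj ((r : ℂ) * Complex.I ^ (k : ℕ)) • B + ((r : ℂ) * Complex.I ^ (k : ℕ)) • Bᴴ)
      = 0 := by
  rw [Finset.sum_add_distrib, ← Finset.sum_smul, ← Finset.sum_smul, sum_conj_nu4, sum_nu4,
    zero_smul, zero_smul, add_zero]

/-- The squares of the source exponents average to the pair anticommutator:
`Σ_k (conj φ_k • B + φ_k • Bᴴ)² = 4r² • (B Bᴴ + Bᴴ B)` (`E φ² = E φ̄² = 0`, `E|φ|² = r²`).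
[folklore] -/
theorem sum_sourceExponent_sq (r : ℝ) (B : Matrix n n ℂ) :
    ∑ k : Fin 4, (conj ((r : ℂ) * Complex.I ^ (k : ℕ)) • B + ((r : ℂ) * Complex.I ^ (k : ℕ)) • Bᴴ) ^ 2
      = (4 * (r : ℂ) ^ 2) • (B * Bᴴ + Bᴴ * B) := by
  have hk : ∀ k : Fin 4,
      (conj ((r : ℂ) * Complex.I ^ (k : ℕ)) • B + ((r : ℂ) * Complex.I ^ (k : ℕ)) • Bᴴ) ^ 2 =
        (conj ((r : ℂ) * Complex.I ^ (k : ℕ))) ^ 2 • (B * B) + (r : ℂ) ^ 2 • (B * Bᴴ) +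
          (r : ℂ) ^ 2 • (Bᴴ * B) + ((r : ℂ) * Complex.I ^ (k : ℕ)) ^ 2 • (Bᴴ * Bᴴ) := by
    intro k
    rw [sq, add_mul, mul_add, mul_add, smul_mul_smul_comm, smul_mul_smul_comm, smul_mul_smul_comm,
      smul_mul_smul_comm, conj_nu4_mul_nu4, mul_comm ((r : ℂ) * Complex.I ^ (k : ℕ)),
      conj_nu4_mul_nu4, ← pow_two (conj ((r : ℂ) * Complex.I ^ (k : ℕ))),
      ← pow_two ((r : ℂ) * Complex.I ^ (k : ℕ))]
    abel
  simp only [hk, Finset.sum_add_distrib, ← Finset.sum_smul, sum_conj_nu4_sq, sum_nu4_sq, zero_smul,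
    zero_add, add_zero, Finset.sum_const, Finset.card_univ, Fintype.card_fin, smul_add]
  norm_num

/-! ### One abstract step: add-and-subtract with second-order cancellation -/

/-- Algebra of the add-and-subtract step. If `G = 1 + x + R_G`, `S = 1 + q + R_S`, `E = 1 + y + R_E`
with the first-order cancellation `q + x = y`, then
`‖G S - E‖ ≤ ‖R_S‖(1 + ‖x‖) + ‖x‖‖q‖ + ‖R_G‖(1 + ‖q‖ + ‖R_S‖) + ‖R_E‖`. [folklore] -/
theorem norm_addSubtract_step_le {𝔸 : Type*} [NormedRing 𝔸] [NormOneClass 𝔸]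
    (x y q RG RS RE : 𝔸) (h : q + x = y) :
    ‖(1 + x + RG) * (1 + q + RS) - (1 + y + RE)‖ ≤
      ‖RS‖ * (1 + ‖x‖) + ‖x‖ * ‖q‖ + ‖RG‖ * (1 + ‖q‖ + ‖RS‖) + ‖RE‖ := by
  have key : (1 + x + RG) * (1 + q + RS) - (1 + y + RE) =
      RS + x * RS + x * q + RG * (1 + q + RS) - RE := by
    rw [← h]; noncomm_ring
  rw [key]
  have e1 := norm_sub_le (RS + x * RS + x * q + RG * (1 + q + RS)) RE
  have e2 := norm_add_le (RS + x * RS + x * q) (RG * (1 + q + RS))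
  have e3 := norm_add₃_le (a := RS) (b := x * RS) (c := x * q)
  have e4 : ‖x * RS‖ ≤ ‖x‖ * ‖RS‖ := norm_mul_le _ _
  have e5 : ‖x * q‖ ≤ ‖x‖ * ‖q‖ := norm_mul_le _ _
  have e6 : ‖RG * (1 + q + RS)‖ ≤ ‖RG‖ * (1 + ‖q‖ + ‖RS‖) :=
    calc ‖RG * (1 + q + RS)‖ ≤ ‖RG‖ * ‖1 + q + RS‖ := norm_mul_le _ _
      _ ≤ ‖RG‖ * (‖(1 : 𝔸)‖ + ‖q‖ + ‖RS‖) := by gcongr; exact norm_add₃_le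
      _ = ‖RG‖ * (1 + ‖q‖ + ‖RS‖) := by rw [norm_one]
  nlinarith [norm_nonneg RS, norm_nonneg x]

/-! ### The slaved slice versus the exact slice: `‖e^{-aH'} S̄ - e^{-aH}‖ = O(a^{3/2})` -/

/-- **Abstract four-point add-and-subtract estimate** (any complete normed `ℂ`-algebra with
`‖1‖ = 1`). If `q + x = y` (first-order cancellation of the penalty), the source exponents `Z_k`
have vanishing sum and `Σ_k Z_k²/2 = 4q` (second moments reproduce the penalty), and `‖Z_k‖ ≤ z`,
then `‖exp x · ¼Σ_{k<4} exp Z_k - exp y‖ ≤ z³eᶻ(1 + ‖x‖) + ‖x‖‖q‖ + ‖x‖²e^{‖x‖}(1 + ‖q‖ + z³eᶻ)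
+ ‖y‖²e^{‖y‖}` (second-order Taylor remainders for `exp x`, `exp y`, third-order for `exp Z_k`).
[folklore] -/
theorem norm_exp_mul_avg_exp_sub_exp_le {𝔸 : Type*} [NormedRing 𝔸] [NormedAlgebra ℂ 𝔸]
    [NormOneClass 𝔸] [CompleteSpace 𝔸] (x y q : 𝔸) (Z : Fin 4 → 𝔸) (hqxy : q + x = y)
    (hZ1 : ∑ k, Z k = 0) (hZ2 : ∑ k, (2 : ℂ)⁻¹ • Z k ^ 2 = (4 : ℂ) • q) {z : ℝ}
    (hz : ∀ k, ‖Z k‖ ≤ z) :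
    ‖exp x * ((1 / 4 : ℂ) • ∑ k, exp (Z k)) - exp y‖ ≤
      z ^ 3 * Real.exp z * (1 + ‖x‖) + ‖x‖ * ‖q‖ +
        ‖x‖ ^ 2 * Real.exp ‖x‖ * (1 + ‖q‖ + z ^ 3 * Real.exp z) + ‖y‖ ^ 2 * Real.exp ‖y‖ := by
  have hz0 : 0 ≤ z := (norm_nonneg _).trans (hz 0)
  set RG : 𝔸 := exp x - 1 - x with hRG_def
  set RE : 𝔸 := exp y - 1 - y with hRE_def
  set T : Fin 4 → 𝔸 := fun k => exp (Z k) - 1 - Z k - (2 : ℂ)⁻¹ • Z k ^ 2 with hT_def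
  set RS : 𝔸 := (1 / 4 : ℂ) • ∑ k, T k with hRS_def
  have hG : exp x = 1 + x + RG := by rw [hRG_def]; abel
  have hE : exp y = 1 + y + RE := by rw [hRE_def]; abel
  have hS : (1 / 4 : ℂ) • ∑ k, exp (Z k) = 1 + q + RS := by
    have e : ∑ k, exp (Z k) = ∑ k, T k + ∑ _k : Fin 4, (1 : 𝔸) + ∑ k, Z k +
        ∑ k, (2 : ℂ)⁻¹ • Z k ^ 2 := by
      rw [← Finset.sum_add_distrib, ← Finset.sum_add_distrib, ← Finset.sum_add_distrib]
      refine Finset.sum_congr rfl fun k _ => ?_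
      simp only [hT_def]; abel
    rw [e, hZ1, hZ2, Finset.sum_const, Finset.card_univ, Fintype.card_fin, hRS_def, smul_add,
      smul_add, smul_add, smul_zero, add_zero, ← Nat.cast_smul_eq_nsmul ℂ, smul_smul, smul_smul]
    norm_num
    abel
  have hRG : ‖RG‖ ≤ ‖x‖ ^ 2 * Real.exp ‖x‖ := norm_exp_sub_one_sub_le ℂ x
  have hRE : ‖RE‖ ≤ ‖y‖ ^ 2 * Real.exp ‖y‖ := norm_exp_sub_one_sub_le ℂ y
  have hT : ∀ k, ‖T k‖ ≤ z ^ 3 * Real.exp z := fun k =>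
    calc ‖T k‖ ≤ ‖Z k‖ ^ 3 * Real.exp ‖Z k‖ := norm_exp_sub_one_sub_sub_le ℂ (Z k)
      _ ≤ z ^ 3 * Real.exp z := by gcongr <;> exact hz k
  have hRS : ‖RS‖ ≤ z ^ 3 * Real.exp z := by
    rw [hRS_def]
    calc ‖(1 / 4 : ℂ) • ∑ k, T k‖ ≤ ‖(1 / 4 : ℂ)‖ * ∑ k, ‖T k‖ := by
          rw [norm_smul]; gcongr; exact norm_sum_le _ _
      _ ≤ ‖(1 / 4 : ℂ)‖ * ∑ _k : Fin 4, z ^ 3 * Real.exp z := by gcongr with k; exact hT k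
      _ = z ^ 3 * Real.exp z := by
          have h4 : ‖(1 / 4 : ℂ)‖ = 1 / 4 := by simp
          rw [Finset.sum_const, Finset.card_univ, Fintype.card_fin, nsmul_eq_mul, h4]
          push_cast
          ring
  rw [hG, hS, hE]
  refine (norm_addSubtract_step_le x y q RG RS RE hqxy).trans ?_
  gcongr

/-- **Per-slice estimate of the slaved representation.** For `H, B` arbitrary `n × n` matrices and
`κ ≥ 0` there is `C = C(‖H‖, ‖B‖, ‖Bᴴ‖, κ)` such that for all `0 ≤ a ≤ 1`, `r ≥ 0` with
`a κ r² = 1` (the surrogate's second moment `r² = 1/(κa)`):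
`‖e^{-a(H + (κ/2){B,Bᴴ})} · ¼Σ_{k<4} e^{aκ(conj φ_k B + φ_k Bᴴ)} - e^{-aH}‖ ≤ C · a (aκr + a)`,
`φ_k = r iᵏ`; note `aκr = (aκ)^{1/2}`, so the right side is `O(a^{3/2})`. Mechanism: vanishing
first moments, `¼Σ_k (source exponent)² /2 = (aκ/2){B,Bᴴ}` cancels the penalty to first order, and
the third-order Taylor remainders are `O((aκ)^{3/2})` (`norm_exp_mul_avg_exp_sub_exp_le`).
[folklore] -/
theorem exists_norm_slavedSlice_sub_gibbsWeight_le [Nonempty n] (H B : Matrix n n ℂ) {κ : ℝ}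
    (hκ : 0 ≤ κ) :
    ∃ C : ℝ, ∀ a r : ℝ, 0 ≤ a → a ≤ 1 → 0 ≤ r → a * κ * r ^ 2 = 1 →
      ‖gibbsWeight a (H + ((κ / 2 : ℝ) : ℂ) • (B * Bᴴ + Bᴴ * B)) *
            ((1 / 4 : ℂ) • ∑ k : Fin 4, gibbsWeight (-(a * κ))
              (conj ((r : ℂ) * Complex.I ^ (k : ℕ)) • B + ((r : ℂ) * Complex.I ^ (k : ℕ)) • Bᴴ))
          - gibbsWeight a H‖ ≤ C * (a * (a * κ * r + a)) := by
  -- the constants (opaque names; nothing is rewritten in the goal)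
  obtain ⟨g, hg⟩ : ∃ g : ℝ, ‖H + ((κ / 2 : ℝ) : ℂ) • (B * Bᴴ + Bᴴ * B)‖ = g := ⟨_, rfl⟩
  obtain ⟨p, hp⟩ : ∃ p : ℝ, ‖((κ / 2 : ℝ) : ℂ) • (B * Bᴴ + Bᴴ * B)‖ = p := ⟨_, rfl⟩
  obtain ⟨h, hh⟩ : ∃ h : ℝ, ‖H‖ = h := ⟨_, rfl⟩
  obtain ⟨b, hb⟩ : ∃ b : ℝ, ‖B‖ + ‖Bᴴ‖ = b := ⟨_, rfl⟩
  have hg0 : 0 ≤ g := hg ▸ norm_nonneg _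
  have hp0 : 0 ≤ p := hp ▸ norm_nonneg _
  have hh0 : 0 ≤ h := hh ▸ norm_nonneg _
  have hb0 : 0 ≤ b := hb ▸ add_nonneg (norm_nonneg _) (norm_nonneg _)
  obtain ⟨A₁, hA₁⟩ : ∃ A₁ : ℝ, κ * b ^ 3 * Real.exp ((1 + κ) * b) * (1 + g) = A₁ := ⟨_, rfl⟩
  obtain ⟨A₂, hA₂⟩ : ∃ A₂ : ℝ, g * p +
      g ^ 2 * Real.exp g * (1 + p + κ * (1 + κ) * b ^ 3 * Real.exp ((1 + κ) * b)) +
        h ^ 2 * Real.exp h = A₂ := ⟨_, rfl⟩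
  have hA₁0 : 0 ≤ A₁ := by rw [← hA₁]; positivity
  have hA₂0 : 0 ≤ A₂ := by rw [← hA₂]; positivity
  refine ⟨A₁ + A₂, fun a r ha0 ha1 hr hakr => ?_⟩
  -- the small parameter `s = aκr = (aκ)^{1/2}`
  obtain ⟨s, hs⟩ : ∃ s : ℝ, a * κ * r = s := ⟨_, rfl⟩
  have hs0 : 0 ≤ s := by rw [← hs]; positivity
  have hs2 : s ^ 2 = a * κ := by
    have e : s ^ 2 = (a * κ) * (a * κ * r ^ 2) := by rw [← hs]; ring
    rw [e, hakr, mul_one]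
  have hs1 : s ≤ 1 + κ := by
    have h1 : s ^ 2 ≤ (1 + κ) ^ 2 := by
      rw [hs2]; nlinarith [mul_le_of_le_one_left hκ ha1, sq_nonneg κ]
    calc s = Real.sqrt (s ^ 2) := (Real.sqrt_sq hs0).symm
      _ ≤ Real.sqrt ((1 + κ) ^ 2) := Real.sqrt_le_sqrt h1
      _ = 1 + κ := Real.sqrt_sq (by positivity)
  have hs3 : s ^ 3 = a * κ * s := by rw [pow_succ, hs2]
  -- unfold the three Gibbs weights into exponentials
  simp only [gibbsWeight, Complex.ofReal_neg, neg_neg]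
  -- the abstract estimate with `x = -aH'`, `y = -aH`, `q = aP'`, `Z_k = aκ W_k`, `z = s b`
  have hqxy : (a : ℂ) • (((κ / 2 : ℝ) : ℂ) • (B * Bᴴ + Bᴴ * B)) +
      -(a : ℂ) • (H + ((κ / 2 : ℝ) : ℂ) • (B * Bᴴ + Bᴴ * B)) = -(a : ℂ) • H := by
    simp only [smul_add, neg_smul]; abel
  have hZ1 : ∑ k : Fin 4, ((a * κ : ℝ) : ℂ) •
      (conj ((r : ℂ) * Complex.I ^ (k : ℕ)) • B + ((r : ℂ) * Complex.I ^ (k : ℕ)) • Bᴴ) = 0 := by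
    rw [← Finset.smul_sum, sum_sourceExponent, smul_zero]
  have hZ2 : ∑ k : Fin 4, (2 : ℂ)⁻¹ • (((a * κ : ℝ) : ℂ) •
      (conj ((r : ℂ) * Complex.I ^ (k : ℕ)) • B + ((r : ℂ) * Complex.I ^ (k : ℕ)) • Bᴴ)) ^ 2 =
        (4 : ℂ) • ((a : ℂ) • (((κ / 2 : ℝ) : ℂ) • (B * Bᴴ + Bᴴ * B))) := by
    simp only [smul_pow, smul_smul, ← Finset.smul_sum]
    rw [sum_sourceExponent_sq]
    simp only [smul_smul]
    congr 1
    have hakr' : ((a : ℂ) * κ) * (r : ℂ) ^ 2 = 1 := by exact_mod_cast hakr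
    push_cast
    linear_combination (2 * (a : ℂ) * κ) * hakr'
  have hz : ∀ k : Fin 4, ‖((a * κ : ℝ) : ℂ) •
      (conj ((r : ℂ) * Complex.I ^ (k : ℕ)) • B + ((r : ℂ) * Complex.I ^ (k : ℕ)) • Bᴴ)‖ ≤ s * b := by
    intro k
    rw [norm_smul, Complex.norm_real, Real.norm_of_nonneg (by positivity : 0 ≤ a * κ)]
    have hW : ‖conj ((r : ℂ) * Complex.I ^ (k : ℕ)) • B + ((r : ℂ) * Complex.I ^ (k : ℕ)) • Bᴴ‖
        ≤ r * b :=
      calc _ ≤ ‖conj ((r : ℂ) * Complex.I ^ (k : ℕ)) • B‖ + ‖((r : ℂ) * Complex.I ^ (k : ℕ)) • Bᴴ‖ :=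
            norm_add_le _ _
        _ = r * b := by
            rw [norm_smul, norm_smul, Complex.norm_conj, norm_nu4, abs_of_nonneg hr, ← hb]; ring
    calc a * κ * _ ≤ a * κ * (r * b) := by gcongr
      _ = s * b := by rw [← hs]; ring
  refine (norm_exp_mul_avg_exp_sub_exp_le _ _ _ _ hqxy hZ1 hZ2 hz).trans ?_
  -- norms of `x`, `y`, `q`
  obtain ⟨X, hX⟩ : ∃ X : ℝ, ‖-(a : ℂ) • (H + ((κ / 2 : ℝ) : ℂ) • (B * Bᴴ + Bᴴ * B))‖ = X := ⟨_, rfl⟩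
  obtain ⟨Y, hY⟩ : ∃ Y : ℝ, ‖-(a : ℂ) • H‖ = Y := ⟨_, rfl⟩
  obtain ⟨Q, hQ⟩ : ∃ Q : ℝ, ‖(a : ℂ) • (((κ / 2 : ℝ) : ℂ) • (B * Bᴴ + Bᴴ * B))‖ = Q := ⟨_, rfl⟩
  rw [hX, hY, hQ]
  have hXa : X = a * g := by
    rw [← hX, ← hg, norm_smul, norm_neg, Complex.norm_real, Real.norm_of_nonneg ha0]
  have hYa : Y = a * h := by
    rw [← hY, ← hh, norm_smul, norm_neg, Complex.norm_real, Real.norm_of_nonneg ha0]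
  have hQa : Q = a * p := by
    rw [← hQ, ← hp, norm_smul, Complex.norm_real, Real.norm_of_nonneg ha0]
  have hX0 : 0 ≤ X := by rw [hXa]; positivity
  have hQ0 : 0 ≤ Q := by rw [hQa]; positivity
  have hY0 : 0 ≤ Y := by rw [hYa]; positivity
  have hXag : X ≤ a * g := hXa.le
  have hYah : Y ≤ a * h := hYa.le
  have hXg : X ≤ g := by rw [hXa]; exact mul_le_of_le_one_left hg0 ha1
  have hYh : Y ≤ h := by rw [hYa]; exact mul_le_of_le_one_left hh0 ha1
  have hQp : Q ≤ p := by rw [hQa]; exact mul_le_of_le_one_left hp0 ha1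
  have hsb : s * b ≤ (1 + κ) * b := mul_le_mul_of_nonneg_right hs1 hb0
  have hz3 : (s * b) ^ 3 * Real.exp (s * b) ≤ a * s * (κ * b ^ 3 * Real.exp ((1 + κ) * b)) :=
    calc (s * b) ^ 3 * Real.exp (s * b) ≤ (s * b) ^ 3 * Real.exp ((1 + κ) * b) := by gcongr
      _ = a * s * (κ * b ^ 3 * Real.exp ((1 + κ) * b)) := by rw [mul_pow, hs3]; ring
  have hz3' : (s * b) ^ 3 * Real.exp (s * b) ≤ κ * (1 + κ) * b ^ 3 * Real.exp ((1 + κ) * b) := by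
    refine hz3.trans ?_
    have has1 : a * s ≤ 1 + κ := by
      have := mul_le_mul ha1 hs1 hs0 zero_le_one; rwa [one_mul] at this
    calc a * s * (κ * b ^ 3 * Real.exp ((1 + κ) * b))
        ≤ (1 + κ) * (κ * b ^ 3 * Real.exp ((1 + κ) * b)) := by gcongr
      _ = κ * (1 + κ) * b ^ 3 * Real.exp ((1 + κ) * b) := by ring
  -- the four terms
  have t1 : (s * b) ^ 3 * Real.exp (s * b) * (1 + X) ≤ a * s * A₁ :=
    calc (s * b) ^ 3 * Real.exp (s * b) * (1 + X)
        ≤ (a * s * (κ * b ^ 3 * Real.exp ((1 + κ) * b))) * (1 + g) := by gcongr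
      _ = a * s * A₁ := by rw [← hA₁]; ring
  have t2 : X * Q ≤ a ^ 2 * (g * p) := by rw [hXa, hQa]; exact le_of_eq (by ring)
  have t3 : X ^ 2 * Real.exp X * (1 + Q + (s * b) ^ 3 * Real.exp (s * b)) ≤
      a ^ 2 * (g ^ 2 * Real.exp g * (1 + p + κ * (1 + κ) * b ^ 3 * Real.exp ((1 + κ) * b))) :=
    calc X ^ 2 * Real.exp X * (1 + Q + (s * b) ^ 3 * Real.exp (s * b))
        ≤ (a * g) ^ 2 * Real.exp g * (1 + p + κ * (1 + κ) * b ^ 3 * Real.exp ((1 + κ) * b)) := by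
          gcongr
      _ = _ := by ring
  have t4 : Y ^ 2 * Real.exp Y ≤ a ^ 2 * (h ^ 2 * Real.exp h) :=
    calc Y ^ 2 * Real.exp Y ≤ (a * h) ^ 2 * Real.exp h := by gcongr
      _ = _ := by ring
  have ha2 : a ^ 2 ≤ a * (s + a) := by linarith [mul_nonneg ha0 hs0]
  have has : a * s ≤ a * (s + a) := by linarith [sq_nonneg a]
  have hsum : (s * b) ^ 3 * Real.exp (s * b) * (1 + X) + X * Q +
      X ^ 2 * Real.exp X * (1 + Q + (s * b) ^ 3 * Real.exp (s * b)) + Y ^ 2 * Real.exp Y ≤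
        a * s * A₁ + a ^ 2 * A₂ := by
    rw [← hA₂]; linarith [t1, t2, t3, t4]
  rw [← hs] at hsum ha2 has ⊢
  calc _ ≤ a * (a * κ * r) * A₁ + a ^ 2 * A₂ := hsum
    _ ≤ a * (a * κ * r + a) * A₁ + a * (a * κ * r + a) * A₂ := by gcongr
    _ = (A₁ + A₂) * (a * (a * κ * r + a)) := by ring

end Summit.HubbardSuperconductivity.HubbardSuperconductivity.Theorems

end
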